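import Literature.Topology.FourManifolds.TrisectionsImplant
import HarnessLib

/-!
# The balanced stabilisation of a trisection in normal form (three implants)

Topic `Literature/Topology/FourManifolds`; infrastructure for the fact seat
`provefact-Literature.Topology.FourManifolds.exists-14560f9fc8` (named fact (c′)
`Literature.Topology.FourManifolds.exists_stabilized_gkTrisection`, Gay–Kirby 2016, Def. 8 and
Lemma 10).  Everything in this file is **proved**; no definitions, no named facts.

* `TriNormalForm.rotate` — the normal form is symmetric under the cyclic rotation of the roles
  `(i, j, l) ↦ (j, l, i)` with `(u, v) ↦ (v - u, -u)` (`NormalFrame.relabelTriRot`).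
* `NormalFrame.exists_ne_mem` — the central surface has a second point near any of its points
  (it is a surface: corner-slice charts).
* `TriNormalForm.exists_stabilization` — **Gay–Kirby's stabilisation in normal form**: three
  implants (`TriNormalForm.exists_implant`), one per sector with the roles rotated, give a
  trisection in normal form whose three counts of index-`1` critical points are each raised by
  one (Gay–Kirby 2016, Def. 8 and Lemma 10: `(g; k₁, k₂, k₃) ↦ (g + 3; k₁ + 1, k₂ + 1, k₃ + 1)`;
  the genus bookkeeping belongs to the recognition step).

## References

* D. Gay, R. Kirby, *Trisecting 4-manifolds*, Geom. Topol. 20 (2016) 3097–3132, Def. 8,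
  Lemma 10. [GayKirby2016]
-/

open scoped Manifold ContDiff Topology
open Set Function Filter

noncomputable section

namespace Literature.Topology.FourManifolds

universe u

section StabilizationNF

variable {X : Type u} [TopologicalSpace X] [T2Space X] [CompactSpace X]
  [ChartedSpace (EuclideanSpace ℝ (Fin 4)) X] [IsManifold (𝓡 4) ∞ X]
  {S : Fin 3 → Set X} {i j l : Fin 3} {u v : X → ℝ} {ρ : X → X} {U O : Set X}
  {c : Fin 3 → ℕ → ℕ}

omit [T2Space X] [CompactSpace X] [IsManifold (𝓡 4) ∞ X] in
/-- **The normal form is symmetric under the cyclic rotation of the roles.**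
[cite: GayKirby2016, Def. 1] -/
theorem TriNormalForm.rotate (hT : TriNormalForm S i j l u v ρ U O c) :
    TriNormalForm S j l i (fun y => v y - u y) (fun y => -u y) ρ U O c := by
  have e1 : (fun y => -u y - (v y - u y)) = fun y => -v y := funext fun y => by ring
  have e2 : (fun y => -(v y - u y)) = fun y => u y - v y := funext fun y => by ring
  have e3 : (fun y => -(-u y)) = u := funext fun y => by ring
  have e4 : (fun y => (v y - u y) - (-u y)) = v := funext fun y => by ring
  have hsl : SectorNormalForm (S l) (⋂ m, S m) (fun y => -u y - (v y - u y)) (fun y => -(v y - u y)) ρ U O (c l) := by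
    rw [e1, e2]; exact hT.sector_l
  have hsi : SectorNormalForm (S i) (⋂ m, S m) (fun y => -(-u y)) (fun y => (v y - u y) - (-u y)) ρ U O (c i) := by
    rw [e3, e4]; exact hT.sector_i
  exact
    { ne_ij := hT.ne_jl
      ne_jl := hT.ne_il.symm
      ne_il := hT.ne_ij.symm
      cover := hT.cover
      frame := hT.frame.relabelTriRot
      mem_j := fun y hy => by
        rw [hT.mem_l y hy]; constructor <;> intro h <;> constructor <;> linarith [h.1, h.2]
      mem_l := fun y hy => by
        rw [hT.sector_i.mem_iff y hy]; constructor <;> intro h <;> constructor <;> linarith [h.1, h.2]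
      sector_i := hT.sector_j
      sector_j := hsl
      sector_l := hsi
      disjoint := hT.disjoint }

omit [T2Space X] [CompactSpace X] [IsManifold (𝓡 4) ∞ X] in
/-- **The central surface has a second point**: it is locally the corner stratum of a
corner-slice chart, a surface. [cite: GayKirby2016, Def. 1] -/
theorem SectorNormalForm.exists_ne_mem {Sm F : Set X} {cm : ℕ → ℕ}
    (hS : SectorNormalForm Sm F u v ρ U O cm) {x : X} (hx : x ∈ F) : ∃ x' ∈ F, x' ≠ x := by
  obtain ⟨C, hxC, -⟩ := hS.corner x hx
  set z : EuclideanSpace ℝ (Fin 4) := C.Θ x with hz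
  have hzT : z ∈ C.Θ.target := C.Θ.map_source hxC
  obtain ⟨ε, hε, hball⟩ := Metric.isOpen_iff.1 C.Θ.open_target z hzT
  set z' : EuclideanSpace ℝ (Fin 4) := z + EuclideanSpace.single 2 (ε / 2) with hz'
  have hz'ball : z' ∈ Metric.ball z ε := by
    rw [Metric.mem_ball, hz', dist_eq_norm, add_sub_cancel_left, EuclideanSpace.single,
      PiLp.norm_single, Real.norm_eq_abs, abs_of_pos (by positivity)]
    linarith
  have hz'T : z' ∈ C.Θ.target := hball hz'ball
  have hz'ne : z' ≠ z := by
    intro h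
    have := congrArg (fun w : EuclideanSpace ℝ (Fin 4) => w 2) h
    simp [hz'] at this
    exact hε.ne' (by linarith)
  obtain ⟨hu0, hv0⟩ := (C.mem_K_iff x hxC).1 hx
  refine ⟨C.Θ.symm z', ?_, fun h => hz'ne ?_⟩
  · have hsrc : C.Θ.symm z' ∈ C.Θ.source := C.Θ.map_target hz'T
    rw [C.mem_K_iff _ hsrc, ← C.apply_zero _ hsrc, ← C.apply_one _ hsrc, C.Θ.right_inv hz'T]
    refine ⟨?_, ?_⟩
    · show z 0 + EuclideanSpace.single (2 : Fin 4) (ε / 2) 0 = 0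
      rw [hz, C.apply_zero x hxC, hu0]; simp
    · show z 1 + EuclideanSpace.single (2 : Fin 4) (ε / 2) 1 = 0
      rw [hz, C.apply_one x hxC, hv0]; simp
  · have := congrArg C.Θ h
    rwa [C.Θ.right_inv hz'T] at this

/-- **Gay–Kirby's stabilisation in normal form** (three implants).  See the module docstring.
[cite: GayKirby2016, Def. 8 and Lemma 10] -/
theorem TriNormalForm.exists_stabilization (hT : TriNormalForm S i j l u v ρ U O c)
    (hne : (⋂ m, S m).Nonempty) :
    ∃ (S' : Fin 3 → Set X) (u' v' : X → ℝ) (ρ' : X → X) (O' : Set X),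
      TriNormalForm S' i j l u' v' ρ' U O' (fun m n => c m n + if n = 1 then 1 else 0) ∧
      (⋂ m, S' m).Nonempty := by
  -- one implant with a prescribed surviving point of the central surface
  have step : ∀ {S₀ : Fin 3 → Set X} {i₀ j₀ l₀ : Fin 3} {u₀ v₀ : X → ℝ} {ρ₀ : X → X} {O₀ : Set X}
      {c₀ : Fin 3 → ℕ → ℕ}, TriNormalForm S₀ i₀ j₀ l₀ u₀ v₀ ρ₀ U O₀ c₀ → (⋂ m, S₀ m).Nonempty →
      ∃ (S₁ : Fin 3 → Set X) (u₁ v₁ : X → ℝ) (ρ₁ : X → X) (O₁ : Set X),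
        TriNormalForm S₁ i₀ j₀ l₀ u₁ v₁ ρ₁ U O₁
          (Function.update c₀ i₀ (fun n => c₀ i₀ n + if n = 1 then 1 else 0)) ∧
        (⋂ m, S₁ m).Nonempty := by
    intro S₀ i₀ j₀ l₀ u₀ v₀ ρ₀ O₀ c₀ hT₀ hne₀
    obtain ⟨x, hx⟩ := hne₀
    obtain ⟨x₁, hx₁, hx₁x⟩ := hT₀.sector_i.exists_ne_mem hx
    obtain ⟨S₁, u₁, v₁, ρ₁, O₁, hT₁, hSagree, -⟩ :=
      hT₀.exists_implant hx (isClosed_singleton (x := x₁)).isOpen_compl (fun h => hx₁x h.symm)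
    refine ⟨S₁, u₁, v₁, ρ₁, O₁, hT₁, ⟨x₁, mem_iInter.2 fun m => ?_⟩⟩
    exact (hSagree m x₁ (fun h => h rfl)).2 (mem_iInter.1 hx₁ m)
  -- three implants with the roles rotated
  obtain ⟨S₁, u₁, v₁, ρ₁, O₁, hT₁, hne₁⟩ := step hT hne
  obtain ⟨S₂, u₂, v₂, ρ₂, O₂, hT₂, hne₂⟩ := step hT₁.rotate hne₁
  obtain ⟨S₃, u₃, v₃, ρ₃, O₃, hT₃, hne₃⟩ := step hT₂.rotate hne₂
  have hT₄ := hT₃.rotate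
  refine ⟨S₃, fun y => v₃ y - u₃ y, fun y => -u₃ y, ρ₃, O₃, ?_, hne₃⟩
  -- the coordinates came back and the counts are the expected ones
  have hij := hT.ne_ij
  have hjl := hT.ne_jl
  have hil := hT.ne_il
  have hc : Function.update (Function.update (Function.update c i fun n => c i n + if n = 1 then 1 else 0) j
        fun n => Function.update c i (fun n => c i n + if n = 1 then 1 else 0) j n + if n = 1 then 1 else 0) l
      (fun n => Function.update (Function.update c i fun n => c i n + if n = 1 then 1 else 0) j
        (fun n => Function.update c i (fun n => c i n + if n = 1 then 1 else 0) j n + if n = 1 then 1 else 0) l n +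
        if n = 1 then 1 else 0) = fun m n => c m n + if n = 1 then 1 else 0 := by
    funext m n
    rcases hT.eq_or m with rfl | rfl | rfl
    · rw [Function.update_of_ne hil, Function.update_of_ne hij, Function.update_self]
    · rw [Function.update_of_ne hjl, Function.update_self, Function.update_of_ne (Ne.symm hij)]
    · rw [Function.update_self, Function.update_of_ne (Ne.symm hjl), Function.update_of_ne (Ne.symm hil)]
  rw [hc] at hT₄
  exact hT₄
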